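import Summits.BirchSwinnertonDyer.BirchSwinnertonDyer.Theorems.ByReductionTypeAtTwoRankOneAtTwoOneDoorLawFirstLayerDefs
import Summits.BirchSwinnertonDyer.BirchSwinnertonDyer.Theorems.ByReductionTypeAtTwoRankOneAtTwoBigImageOddLocalOneDoorSubslicePosDisc
import Summits.BirchSwinnertonDyer.BirchSwinnertonDyer.Theorems.ByReductionTypeAtTwoRankOneAtTwoBigImageOddLocalOneDoorSubsliceNegDisc
import Summits.BirchSwinnertonDyer.BirchSwinnertonDyer.Theorems.GenusKolyvaginAtTwoGenusPrimitiveSupplyAtTwoArchimedeanRowsHold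
import HarnessLib

/-!
# Route ByReductionTypeAtTwo, crux `RankOneAtTwoBigImageOddLocal` (stmt-BirchSwinnertonDyer-23715), LINE v8.17 `one_door_analytic`:
# THE v8.17 RESHAPE DOES NOT ENLARGE THE CONE — R₀ follows from v8.16's pair (R⁻₀, AN-13) modulo print

Lead prover seat `bsd-line-fkl-p1` g16 (2026-08-28), `--supports stmt-BirchSwinnertonDyer-23715` (helper).  THEOREMS ONLY; no definition, no named fact
introduced, no `sorry`; conditional by design (the residues R⁻₀ / AN-13 and the four primary printed facts are hypotheses where named).  BSD is not proved by
any of this.  Companion of `Theorems/…OneDoorSubsliceFirstLayer.lean` (R₀ ⟹ R⁻₀; R₀ puts the egg class on the sub-slice; the v8.17 composition; losslessness).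

The sign-free first-layer residue R₀ `HeegnerNonDivisibilityAtSelmerTrivialMinimalDoorAtTwo` quantifies over door-admissible MINIMAL doors (`t + 2s = [Δ_W < 0]`) with a
`Sel₂`-trivial twin.  Read back in v8.16's vocabulary:
* the counts decide the primes of `d` — TREE lemmas of the width seat fkl-p2 g13 (`…OneDoorSubsliceDescentBits.lean` / `…OneDoorBottomAssemblyNeg.lean`):
  `t = s = 0` ⟹ desc-admissible (`descAdmissible_of_doorAdmissible_of_counts_eq_zero`), `t = 1`, `s = 0` ⟹ transposition-admissible at the one symbol-`−1`
  prime (`exists_transpositionPrime`, `transpAdmissible_of_doorAdmissible_of_counts`) — reused BY NAME;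
* §1 a `Sel₂`-trivial twin FORCES the door bit: at `Δ_W < 0` `#Sel₂(W^{(d)}) = 1 ⟹ MeetsNonNormAt W q₀` by route GenusKolyvaginAtTwo's PROVED transposition twist law
  (`GenusKolyTransp.transpositionTwistLawAtTwo_holds`: otherwise `#Sel₂ = 4`), at `Δ_W > 0` `#Sel₂(W^{(d)}) = 1 ⟹ MeetsEgg W` by the PROVED egg twist law
  (`GenusKolyArch.eggTwistLawAtTwo_holds`);
* §2 hence **`kolyvaginTwo_of_heegnerNonDiv_of_heegnerPointOnEgg`**: R⁻₀ ∧ AN-13 ⟹ R₀ modulo Gross–Zagier, Kolyvagin, modularity, Hoffstein–Luo (only for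
  `rank E(ℚ) = 1`, an input of the two twist laws and of AN-13) — with `…FirstLayer.lean` §1 (R₀ ⟹ R⁻₀) the `Δ_W < 0` halves are EQUIVALENT modulo print, and at
  `Δ_W > 0` R₀ is AN-13 restricted to the slice's `Sel₂`-trivial doors read through the egg lemma.

References: [Kramer1981] Prop. 3, Prop. 6; [MazurRubin2010] Prop. 3.3, Cor. 3.4 (i); [Zhang2014CJM] Thm. 1.1 (shape); [GrossLMS1991] Conj. 1.2, §10;
[SilvermanAEC2009] VII.5.1, V.2.3.1.
-/

set_option autoImplicit false
-- the Theorems namespace of this sub repeats the summit name by design (D-0017 nested layout)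
set_option linter.dupNamespace false

noncomputable section

open scoped Classical

namespace Summit.BirchSwinnertonDyer.BirchSwinnertonDyer.Theorems.RankOneAtTwoOneDoor

open WeierstrassCurve NumberField Literature.NumberTheory.EllipticCurves Literature.NumberTheory.EllipticCurves.ModularForms
  Summit.BirchSwinnertonDyer.Rank1Residual.F1Sign2
  Summit.BirchSwinnertonDyer.Rank1Residual.F1Sign2.TranspositionDoor
  Summit.BirchSwinnertonDyer.BirchSwinnertonDyer.Theses.ByReductionTypeAtTwo
open Summit.BirchSwinnertonDyer.BirchSwinnertonDyer.Theorems.GenusKolyArch (eggTwistLawAtTwo_holds)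
open Summit.BirchSwinnertonDyer.BirchSwinnertonDyer.Theorems.GenusKolyTransp (transpositionTwistLawAtTwo_holds)

/-! ### §1 A `Sel₂`-trivial twin forces the door bit (the two PROVED twist laws) -/

/-- **`#Sel₂(W^{(d)}) = 1` at a transposition-admissible door of a rank-one `Ш[2] = 0` curve with `Δ_W < 0` FORCES `MeetsNonNormAt W q₀`** — route
GenusKolyvaginAtTwo's proved transposition twist law (Mazur–Rubin 2010 Cor. 3.4 (i) at `T = {q₀}`): otherwise `#Sel₂(W^{(d)}) = 4`. [cite: MazurRubin2010, Prop. 3.3 and Cor. 3.4 (i)]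
[cite: Kramer1981, Prop. 3] -/
theorem meetsNonNormAt_of_twistSelmerTwoCard_eq_one (W : WeierstrassCurve ℚ) [W.IsElliptic] [W.IsGloballyMinimal]
    (hΔ : W.Δ < 0) (hT : NoRationalTwoTorsion W) (hrk : W.mordellWeilRank = 1) (hSha : ShaTwoTrivial W)
    {d : ℤ} {q₀ : ℕ} [Fact q₀.Prime] (htr : TranspAdmissible W d q₀) (hsel : twistSelmerTwoCard W d = 1) : MeetsNonNormAt W q₀ := by
  by_contra hnn
  have h4 : twistSelmerTwoCard W d = 4 := (transpositionTwistLawAtTwo_holds W hΔ hT hrk hSha d q₀ htr).2 hnn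
  omega

/-- **`#Sel₂(W^{(d)}) = 1` at a desc-admissible door of a rank-one `Ш[2] = 0` curve with `Δ_W > 0` FORCES `E(ℚ)` TO MEET THE EGG** — route GenusKolyvaginAtTwo's
proved egg twist law (Kramer 1981 Prop. 6 at the real place): otherwise `#Sel₂(W^{(d)}) = 4`. [cite: Kramer1981, Prop. 6] [cite: MazurRubin2010, Prop. 3.3] -/
theorem meetsEgg_of_twistSelmerTwoCard_eq_one (W : WeierstrassCurve ℚ) [W.IsElliptic] [W.IsGloballyMinimal]
    (hΔ : 0 < W.Δ) (hT : NoRationalTwoTorsion W) (hrk : W.mordellWeilRank = 1) (hSha : ShaTwoTrivial W)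
    {d : ℤ} (hDA : DescAdmissible W d) (hsel : twistSelmerTwoCard W d = 1) : MeetsEgg W := by
  by_contra hm
  have h4 : twistSelmerTwoCard W d = 4 := (eggTwistLawAtTwo_holds W hΔ hT hrk hSha d hDA).2 hm
  omega

/-! ### §2 R⁻₀ ∧ AN-13 ⟹ R₀ (modulo print): the cone of v8.17 is contained in the cone of v8.16 -/

/-- **v8.16's PAIR GIVES v8.17's STUB: R⁻₀ `HeegnerNonDivisibilityAtSelmerTrivialPrimeDoorAtTwo` ∧ AN-13 `F1Sign2.HeegnerPointOnEggAtTwo` ⟹ R₀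
`HeegnerNonDivisibilityAtSelmerTrivialMinimalDoorAtTwo`**, modulo Gross–Zagier, Kolyvagin, modularity, Hoffstein–Luo (for `rank E(ℚ) = 1` from analytic rank `1`).
At a door-admissible minimal `Sel₂`-trivial door: if `Δ_W < 0` then `t = 1`, `s = 0`, so the door is transposition-admissible at its symbol-`−1` prime `q₀` (fkl-p2's counting lemmas) and open
there (§1), and R⁻₀ applies verbatim; `Δ_W = 0` is excluded (`W` elliptic); if `Δ_W > 0` then `t = s = 0`, so `d_K` is desc-admissible (fkl-p2), `E(ℚ)` meets the egg (§1),
AN-13 puts the Heegner point on the egg up to torsion, and the egg lemma (`hasTwoDivisibilityUpToTorsion_zero_of_eggUpToTorsion`, unconditional) gives exponent `0`.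
So replacing the pair by R₀ in the skeleton does not enlarge the cone of the crux; with `…FirstLayer.lean` §1 the `Δ_W < 0` statements are equivalent modulo print.
CONDITIONAL by design; BSD is not proved by this. [cite: Zhang2014CJM, Thm. 1.1 (shape)] [cite: Kramer1981, Prop. 3 and Prop. 6] [cite: MazurRubin2010, Cor. 3.4 (i)]
[cite: GrossZagier1986, Thm. I.6.3 and V.§2] -/
theorem kolyvaginTwo_of_heegnerNonDiv_of_heegnerPointOnEgg
    (hGZ : ∀ (N : ℕ) [NeZero N] (W : WeierstrassCurve ℚ) (K : Type) [Field K] [NumberField K], gross_zagier N W K)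
    (hKo : ∀ (N : ℕ) [NeZero N] (W : WeierstrassCurve ℚ) (K : Type) [Field K] [NumberField K], kolyvagin N W K)
    (hnf : exists_isNewformOf) (hHL : HoffsteinLuo1997_exists_twist_L_one_ne_zero)
    (hR : HeegnerNonDivisibilityAtSelmerTrivialPrimeDoorAtTwo) (h13 : HeegnerPointOnEggAtTwo) :
    HeegnerNonDivisibilityAtSelmerTrivialMinimalDoorAtTwo := by
  intro W _ _ _ hCM hsurj hT hc hr hSha K _ _ hK hadm hmin hcop hHN hsel Dt H ι P hP hodd
  have hT2 : NoRationalTwoTorsion W := noRationalTwoTorsion_of_odd_torsionOrder W hT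
  have hrk : W.mordellWeilRank = 1 := (mordellWeilRank_eq_one_of_analyticRank_eq_one_of_isGloballyMinimal hGZ hKo hnf hHL W hr).1
  rcases lt_trichotomy W.Δ 0 with hΔ | hΔ0 | hΔ
  · -- `Δ_W < 0`: the one error place is a transposition prime
    rw [if_pos hΔ] at hmin
    have ht : transpCount W (NumberField.discr K) = 1 := by omega
    have hs : identCount W (NumberField.discr K) = 0 := by omega
    obtain ⟨q₀, hq₀, hq₀d, hjac, -, -, -⟩ := exists_transpositionPrime W hadm ht
    have htr : TranspAdmissible W (NumberField.discr K) q₀ := transpAdmissible_of_doorAdmissible_of_counts W hadm ht hs hq₀ hq₀d hjac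
    haveI : Fact q₀.Prime := ⟨hq₀⟩
    have hnn : MeetsNonNormAt W q₀ := meetsNonNormAt_of_twistSelmerTwoCard_eq_one W hΔ hT2 hrk hSha htr hsel
    exact hR W hCM hsurj hT hc hr hΔ hSha K hK q₀ htr hnn hcop hHN hsel Dt H ι P hP hodd
  · exact absurd hΔ0 W.isUnit_Δ.ne_zero
  · -- `Δ_W > 0`: the one error place is the real place
    rw [if_neg (not_lt.mpr hΔ.le)] at hmin
    have ht : transpCount W (NumberField.discr K) = 0 := by omega
    have hs : identCount W (NumberField.discr K) = 0 := by omega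
    have hDA : DescAdmissible W (NumberField.discr K) := descAdmissible_of_doorAdmissible_of_counts_eq_zero W hadm ht hs
    have hmeets : MeetsEgg W := meetsEgg_of_twistSelmerTwoCard_eq_one W hΔ hT2 hrk hSha hDA hsel
    have hc2 : ¬ 2 ∣ W.tamagawaProduct := fun h => (Nat.not_even_iff_odd.mpr hc) (even_iff_two_dvd.mpr h)
    have hcodd : ¬ (2 : ℤ) ∣ Dt.c := fun h => (Int.not_even_iff_odd.mpr hodd) (even_iff_two_dvd.mpr h)
    have hegg : EggUpToTorsion W K P := h13 W hΔ hT2 hrk hSha hmeets hc2 K hK hDA Dt H ι P hP hcodd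
    exact hasTwoDivisibilityUpToTorsion_zero_of_eggUpToTorsion W hΔ hT2 K hK P hegg

end Summit.BirchSwinnertonDyer.BirchSwinnertonDyer.Theorems.RankOneAtTwoOneDoor

end
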